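import Literature.MathematicalPhysics.QuantumFieldTheory.Balaban1983to89.T4AdjointCovariance
import Literature.MathematicalPhysics.QuantumFieldTheory.Balaban1983to89.T4AveragingDisintegration
import Literature.MathematicalPhysics.QuantumFieldTheory.Balaban1983to89.B10Eq42TorusConstraint
import Literature.MathematicalPhysics.QuantumFieldTheory.Balaban1983to89.Node00.LargeFieldReprOfRecord

/-!
# NODE 00 — DEFINER ₇b (T-side), FILE 11a: the multi-scale integral operation 𝐓_k({Ω_j},{Λ_j},{S_j}) of (2.18)–(2.22) [III]
# OF RECORD — typed as DEFINITIONS over the tree's `Form`∕`Op` algebra (`T4NestedCovariance`), its (2.21) fibre nodes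
# (`T4AdjointCovariance`) and the disintegration kernel of block averaging (`T4AveragingDisintegration`), in r11's slot shape
# `B14.Eq218Concrete.Data218.Tk : Seq D k → (𝔄 → MSField P G → ℝ) → Density P k G`

Cell `pub-ymgap`, NODE 00, definer seat ₇b∕₉∕₁₀∕₁₁ (`pub-ymgap-node00-def-T`), DEDUP №11 step 11a (dag-lead TABLE v14; director LINE №54: 11a → 11b
`Sect2FrameOfRecord` → 11c `Sect2FormOfRecord` → 11d `Record11` = the restate predicate).  [I] = [Balaban1987RG1], [III] = [Balaban1988Convergent],
[IV] = [Balaban1989LargeFieldI].  Source displays read on the rendered PDF of [III] (held `paper:balaban1988-cmp119-convergent-renormalization`,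
journal page = PDF page + 242), pp. 256–258 and 269–270:

  (2.18)  `ρ_k(V_k) = Σ_{{Ω_j},{Λ_j}} χ_k(Ω_k) 𝐓_k({Ω_j},{Λ_j}) exp A_k({Ω_j},{Λ_j})` — r11's `B14.Eq218Concrete` types the sum WITH BODY and keeps
          the `{S_j}`-data of (2.1) inside the operand slot `𝔄`;
  (2.19)  `𝐓_k = ∏_{X ∈ components of Z_k} 𝐓_k(X)`;   (2.20)  `𝐓_k(X) = ∏_{j=k−1}^{0} 𝐓^{(j)}(Z_{j+1} ∩ X)` (an ORDERED product, the newest generation last);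
  (2.21)  `𝐓^{(j)}(Z_{j+1} ∩ X) = ∫ dV_j|_{Ω^c_{j+1} ∩ X} δ(V̄_j V_{j+1}⁻¹) ζ(Ω^c_{j+1}) ∫ dA_j|_{Z_{j+1} ∩ Ω_{j+1} ∩ X} χ(Z_{j+1} ∩ Ω_{j+1} ∩ X, S_{j+1})
          exp[−½⟨A_j, C*Δ^{(j)}CA_j⟩ + ½⟨A_j, C*Δ^{(j)}CC^{(j)}(Λ_{j+1})C*Δ^{(j)}CA_j⟩]` *«if the last set is nonempty … This is the form if not changed by an
          𝐑-operation»* (p. 258);   (2.22) the same without the A-integral when `Z_{j+1} ∩ Ω_{j+1} ∩ X = ∅`;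
  (3.24)  `𝐓_{k+1}({Ω_j},{Λ_j},{S_j}) = 𝐓^{(k)}(…) 𝐓_k(…)` (p. 270) — the recursion this file takes as the DEFINITION of the ordered product (2.20).

WHAT THIS FILE IS.  FILE 4 (`LargeFieldReprOfRecord`) carried `𝐓_k exp A_k` as ONE residual datum per sequence (`TexpAOfRecord`), and FILE 10 (`Record10`)
closes the record on it; the restate predicate `Record11` must instead PIN the form of that datum — «slot `s` = 𝐓_k(s)[exp A_k(s)] on the support of
`χ_k(s)`» (11c) — so that the (2.18)∕(2.23) laws are not junk-closable.  This file types the OPERATOR HALF: 𝐓_k(s) as a definition.  THE VEHICLE is the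
tree's (cell pub-balaban): an integral operation is an `Op Ω E = (Ω → E) → (Ω → E)` on ONE configuration type (`T4NestedCovariance`, «it is convenient to
keep one configuration type»); the (2.21) A-factor is the `Form` `fluctForm sA w = fibreNodeA sA ∘ mul w` on the joint one-scale configuration
`JCfg P j G V = GaugeField P j G × VecField P j V` (`T4AdjointCovariance` §4); the δ-CONSTRAINED V-integration `∫ dV_j|_{s} δ(V̄_j V_{j+1}⁻¹) (·)`, which the
fixed-measure fibre leaves of `Form` cannot express, is the DISINTEGRATION KERNEL of product Haar on the integrated bond variables along the (restricted)
block averaging, read at the next scale's variables — `T4AveragingDisintegration.kernelTransport` (marginal density × conditional law), i.e. FILE 1's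
modelling decision for the T-step (`transportOfRecord = transportK`) one layer down, RESTRICTED to a bond set as print restricts `dV_j` to `Ω^c_{j+1} ∩ X`.
VERSION CAVEAT inherited from FILE 1∕`T4AveragingDisintegration`: the kernel transport is an `rnDeriv`-VERSION, determined only `μ`-a.e. in the next-scale
variables; pointwise readings of it are readings of a version (K0 census (R-c): a continuous-version instantiation is for a successor — the one-generation
datum `GenData` is TRANSPORT-GENERIC in its V-factor `vT` precisely so that it can be swapped without retyping anything else).

CONTENTS.  §1 (generic: any lattice parameters `P`, group `G`, fluctuation value space `V`): the ALL-SCALES configuration `MultiCfg P G V = (j : ℕ) → JCfg P j G V`,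
the lift `liftOp` of one-scale operations, scalar weights `zetaOp`, the ordered product `tkOp gen : ℕ → Op` BY RECURSION ((2.20)∕(3.24) definitional:
`tkOp_succ`), the base configuration `baseCfg` and the value-level reading `atScale` ∕ the BRIDGE `tkOn218` to r11's operand shape
`𝔄 → MSField P G → ℝ` with `𝔄 := SFluct P V = ({S_j}-sequence) × (all-scale fluctuation fields)`; restricted transports `RestrTransport G ι ι'` with the
kernel version `kernelRT avg` and its PROVED faces (positivity `kernelRT_posPres`, the Markov face `kernelRT_const`, the empty-bond-set face
`kernelRT_of_isEmpty`); the V-factor `vOp`, the A-factor `aOp` (= the tree's `fluctForm`, `aOp_eq_fluctForm_eval` by `rfl`), one generation's data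
`GenData` {V-bonds `sV`, image bonds `sV'`, transport `vT`, weight `ζ`, A-bonds `sA`, A-weight `w`} with its displayed `Laws`, the generation
`genOp = vOp ∘ zetaOp ∘ aOp` ((2.21): the A-integral inside the V-integral, as printed) and the faces `aOp_nonneg`∕`genOp_nonneg`∕`tkOp_nonneg` (positivity),
`aOp_of_indep` (an operand not depending on the integrated fluctuation variables comes out multiplied by the normaliser `∫ w` — the E-bookkeeping shape),
`aOp_of_isEmpty`∕`vOp_kernelRT_of_isEmpty` ((2.22) and the no-large-field generation: no variables ⇒ no integral), `vOp_kernelRT_of_indep`.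
§2 (generic over r11's index `Seq D k` on a finite lattice): the `{S_j}`-INDEX of (2.1) p. 254 *«S_j ⊂ Ω_j ∩ Λ_jᶜ, and S_j is either empty, or it is a union of
LM₂R_j-cubes»* as the finite set `admSSeq C k s` of sequences normalised to `∅` off the window (`admS_finite`, `mem_admSSeq_iff`, `const_empty_mem_admSSeq`,
`admSSeq_zero`, `admSSeq_of_eq`: in the no-large-field branch `Λ_j = Ω_j` the index is the all-empty sequence alone).
§3 OF RECORD (`G = SU(N)`, Bałaban's averaging of record, r11's sequences of record `SeqOfRecord F ν M g K k`): the restricted averaging `avgRestrOfRecord`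
(`avOfRecord` on the field extended by `1` off the bond set), the kernel transport of record `kernelRTOfRecord`, the S-classes of record `SClassOfRecord`
(unions of `LM₂R_j`-cubes, `cubeSide L M₂ R_j j` as in `chiSeqOfRecord`) and `admSOfRecord`, the REGION-INDEXED RESIDUAL WEIGHT DATUM `TkWeights F N V K`
{`ζ j Y` = ζ_j(Y) (Y = Ω^c_{j+1}: resummed characteristic functions and gauge-fixing factors, p. 248∕267), `quad j Λ'` = the value `⟨A_j, 𝒬_j(Λ') A_j⟩` of [I]'s
fluctuation form at the background field of the retained variables ((1.15)–(1.16), (1.26) [III]; NOT constructed here), `chiA j Y S` = χ(Y, S) of (2.21)∕(3.21)}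
with `TkWeights.w` = `χ · exp(−½·quad)` and the displayed `TkWeights.Laws` (ζ ≥ 0, 0 ≤ χ ≤ 1), one generation of record `genDataOfRecord` (V-bonds = the
level-`j` bonds in `Ω^c_{j+1}` (`B10Eq42TorusConstraint.bondsIn`), image = the level-`(j+1)` bonds there, A-bonds = the level-`j` bonds in `Z_{j+1} ∩ Ω_{j+1}`,
`Z_j = Λ_jᶜ` (2.3)), the branch operator `tkBranchOfRecord … s S` and **`TkOfRecord F N V ν M g K W k s : (SFluct → MSField → ℝ) → Density (F.P K) k (SU N)`** =
`Σ_{S ∈ admSOfRecord} (𝐓_k(s, S) F(S, ·))(V_k)` — r11's slot shape `Data218.Tk s` VERBATIM.  §4 FACES: `TkOfRecord_zero` (k = 0: evaluation at the Wilson-start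
configuration, the only admissible S-sequence being the empty one), `TkOfRecord_of_eq` (no large field on the window ⇒ the single all-empty branch),
`tkBranchOfRecord_succ` ((3.24), `rfl`), `TkOfRecord_nonneg` (positivity under `TkWeights.Laws` for nonnegative operands — the shape FILE 10's `0 ≤ slot` proviso
and 11c's identity law consume), `genDataOfRecord_laws`, `genOp_of_isEmpty` (a generation with empty bond sets is multiplication by its weights).

HONEST SCOPE.  Definitions of record + kernel∕integral bookkeeping; every face is PROVED from displayed hypotheses or is `rfl`; 0 `sorry`; no `instance`, no
`notation`.  NOT ASSERTED: anything of Bałaban — Theorem 2 [III], the inductive hypotheses (2.23)–(2.43), the §3 computation (3.10)–(3.25) producing the new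
terms, the linearization `𝐓′_{k+1}` of (3.25), positivity of [I]'s forms `𝒬_j`, the bounds on ζ, χ.  NOT TYPED HERE (successors, located): (2.19) as a
commuting-product face over the components of `Z_k` (the ordered product over ALL of `Z_{j+1}` is taken at once — for disjoint bond sets the generations over
different components commute by Fubini; not needed by 11b–11d); the layer convention of (2.1) *«it contains Ω_j ∖ Ω_j^{∼−1}»* and the large-fluctuation
functions on `R_j` are carried by the residual weight `chiA` (χ(Y, S) := 0 on the S the convention excludes), NOT by the index `admSSeq` — a located
simplification SAID here; measurability∕integrability provisos of the generation integrands are displayed where a face needs them (`aOp_of_indep` needs none);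
the WEIGHTS OF RECORD (ζ from [15]'s gauge fixing, `quad` from [I]'s `C`, `Δ^{(j)}`, `C^{(j)}(Λ_{j+1})` — `B12Eq15QuadraticForm`-shaped objects) stay the
RESIDUAL DATUM `TkWeights`, exactly as FILE 1's step weights `StepWeightsOfRecord`; the un-integrated variables of scales `< k` are read at the base
configuration (`1`, `0`) — print has no such variables left (they were integrated by the small-field steps), and an operand of r11's shape reads the retained
ones only through the determining set.  One finite `T⁴` torus at fixed `ε = L^{−K}`; not continuum ∕ OS ∕ mass-gap ∕ Clay; counts unmoved.
-/

noncomputable section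

open MeasureTheory

namespace Literature.MathematicalPhysics.QuantumFieldTheory.Balaban1983to89.Node00

open T4NestedCovariance T4AdjointCovariance T4AveragingDisintegration T4Continuum T4FiniteEpsInhabited

namespace Tk

universe u

/-! ## §1  The operator algebra of (2.20)–(2.21) on the all-scales configuration (generic) -/

section Generic

variable {P : Params} {G : Type u} {V : Type u}

/-- ALL-SCALES CONFIGURATION: at every scale `j` the pair (gauge variables `V_j`, fluctuation variables `A_j`) (the tree's joint one-scale configuration
`JCfg P j G V`); an operation integrates some of them and reads the others. [cite: Balaban1988Convergent, (2.10) p.256, (2.21) p.258] -/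
abbrev MultiCfg (P : Params) (G : Type u) (V : Type u) : Type u := (j : ℕ) → JCfg P j G V

/-- LIFT of a one-scale operation (acting on functions of `(V_j, A_j)`) to the all-scales configuration: freeze the other scales.
[cite: Balaban1988Convergent, (2.21) p.258] -/
def liftOp (j : ℕ) {E : Type*} (T : Op (JCfg P j G V) E) : Op (MultiCfg P G V) E :=
  fun F ω => T (fun c => F (Function.update ω j c)) (ω j)

/-- `liftOp` unfolded. [cite: Balaban1988Convergent, (2.21) p.258] -/
theorem liftOp_apply (j : ℕ) {E : Type*} (T : Op (JCfg P j G V) E) (F : MultiCfg P G V → E) (ω : MultiCfg P G V) :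
    liftOp j T F ω = T (fun c => F (Function.update ω j c)) (ω j) := rfl

/-- SCALAR WEIGHT on the all-scales configuration (`ζ(Ω^c_{j+1})`, the A-weights): multiplication, the tree's `mulOp`. [cite: Balaban1988Convergent, (2.21) p.258] -/
def zetaOp (ζ : MultiCfg P G V → ℝ) : Op (MultiCfg P G V) ℝ :=
  fun F ω => ζ ω * F ω

/-- `zetaOp` unfolded. [cite: Balaban1988Convergent, (2.21) p.258] -/
theorem zetaOp_apply (ζ : MultiCfg P G V → ℝ) (F : MultiCfg P G V → ℝ) (ω : MultiCfg P G V) : zetaOp ζ F ω = ζ ω * F ω := rfl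

/-- `zetaOp` is the tree's multiplication operation `mulOp`. [cite: Balaban1988Convergent, (2.21) p.258] -/
theorem zetaOp_eq_mulOp (ζ : MultiCfg P G V → ℝ) : zetaOp ζ = (mulOp ζ : Op (MultiCfg P G V) ℝ) := rfl

/-- **THE ORDERED PRODUCT (2.20) BY RECURSION**: `𝐓_0 = id`, `𝐓_{k+1} = 𝐓^{(k)} 𝐓_k` ((3.24) p. 270 in §2's indexing) — the newest generation acts last,
i.e. outermost. [cite: Balaban1988Convergent, (2.20) p.258, (3.24) p.270] -/
def tkOp (gen : ℕ → Op (MultiCfg P G V) ℝ) : ℕ → Op (MultiCfg P G V) ℝ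
  | 0 => fun F => F
  | k + 1 => fun F => gen k (tkOp gen k F)

/-- `𝐓_0` is the identity (no large-field variables before the first step). [cite: Balaban1988Convergent, (2.20) p.258] -/
@[simp] theorem tkOp_zero (gen : ℕ → Op (MultiCfg P G V) ℝ) (F : MultiCfg P G V → ℝ) : tkOp gen 0 F = F := rfl

/-- **(3.24)**∕(2.20): `𝐓_{k+1} F = 𝐓^{(k)} (𝐓_k F)`. [cite: Balaban1988Convergent, (3.24) p.270] -/
@[simp] theorem tkOp_succ (gen : ℕ → Op (MultiCfg P G V) ℝ) (k : ℕ) (F : MultiCfg P G V → ℝ) :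
    tkOp gen (k + 1) F = gen k (tkOp gen k F) := rfl

/-- POSITIVITY of the ordered product: if every generation preserves nonnegativity, so does `𝐓_k`. [cite: Balaban1988Convergent, (2.20) p.258] -/
theorem tkOp_nonneg (gen : ℕ → Op (MultiCfg P G V) ℝ) (hgen : ∀ j (F : MultiCfg P G V → ℝ), (∀ ω, 0 ≤ F ω) → ∀ ω, 0 ≤ gen j F ω)
    (k : ℕ) {F : MultiCfg P G V → ℝ} (hF : ∀ ω, 0 ≤ F ω) (ω : MultiCfg P G V) : 0 ≤ tkOp gen k F ω := by
  induction k generalizing ω with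
  | zero => exact hF ω
  | succ k ih => exact hgen k _ ih ω

/-- THE BASE CONFIGURATION through which a result is read as a function of `V_k` alone: `V_k` at scale `k`, unit gauge variables and zero fluctuation
variables elsewhere (print has no un-integrated variables of scales `< k` left; an operand of r11's shape reads the retained ones through the determining
set only). [cite: Balaban1988Convergent, (2.18) p.257] -/
def baseCfg [One G] [Zero V] (k : ℕ) (Vk : GaugeField P k G) : MultiCfg P G V :=
  fun j => (fun b => if h : j = k then Vk (h ▸ b) else 1, fun _ => 0)

/-- The fluctuation variables of the base configuration are `0`. [cite: Balaban1988Convergent, (2.18) p.257] -/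
@[simp] theorem baseCfg_snd [One G] [Zero V] (k j : ℕ) (Vk : GaugeField P k G) : ((baseCfg (V := V) k Vk) j).2 = 0 := rfl

/-- THE VALUE-LEVEL READING: `(𝐓_k F)(V_k)`. [cite: Balaban1988Convergent, (2.18) p.257] -/
def atScale [One G] [Zero V] (gen : ℕ → Op (MultiCfg P G V) ℝ) (k : ℕ) (F : MultiCfg P G V → ℝ) : GaugeField P k G → ℝ :=
  fun Vk => tkOp gen k F (baseCfg k Vk)

/-- At level `0` the reading is evaluation at the base configuration. [cite: Balaban1988Convergent, (2.20) p.258] -/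
theorem atScale_zero [One G] [Zero V] (gen : ℕ → Op (MultiCfg P G V) ℝ) (F : MultiCfg P G V → ℝ) (V0 : GaugeField P 0 G) :
    atScale gen 0 F V0 = F (baseCfg 0 V0) := rfl

/-- One more generation before reading: `(𝐓_{k+1} F)(V_{k+1}) = (𝐓^{(k)} (𝐓_k F))(base_{k+1} V_{k+1})`. [cite: Balaban1988Convergent, (3.24) p.270] -/
theorem atScale_succ [One G] [Zero V] (gen : ℕ → Op (MultiCfg P G V) ℝ) (k : ℕ) (F : MultiCfg P G V → ℝ) (Vk : GaugeField P (k + 1) G) :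
    atScale gen (k + 1) F Vk = gen k (tkOp gen k F) (baseCfg (k + 1) Vk) := rfl

/-- THE ALL-SCALE FLUCTUATION VARIABLES `{A_j}`. [cite: Balaban1988Convergent, (2.10) p.256, (2.21) p.258] -/
abbrev MSFluct (P : Params) (V : Type u) : Type u := (j : ℕ) → VecField P j V

/-- **r11's OPERAND-SLOT INDEX `𝔄` MADE CONCRETE**: a `{S_j}`-sequence of (2.1) (as level-`0` site regions, normalised to `∅` off the window like r11's `Seq`)
together with the all-scale fluctuation variables — *«r11 keeps the {S_j}-data inside 𝔄»* (`B14.Eq218Concrete`, module docstring).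
[cite: Balaban1988Convergent, (2.1) p.254, (2.18) p.257] -/
abbrev SFluct (P : Params) (V : Type u) := (ℕ → Set (Site P 0)) × MSFluct P V

/-- **THE BRIDGE TO r11's SLOT SHAPE** `(𝔄 → MSField P G → ℝ) → Density P k G` for ONE `{S_j}`-branch: the operator read on an operand of r11's shape
(`B15DeterminingSets.MSField` = all-scale gauge variables) at the branch `S`. [cite: Balaban1988Convergent, (2.18) p.257] -/
def tkOn218 [One G] [Zero V] (gen : ℕ → Op (MultiCfg P G V) ℝ) (k : ℕ) (S : ℕ → Set (Site P 0))
    (F : SFluct P V → B15DeterminingSets.MSField P G → ℝ) : GaugeField P k G → ℝ :=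
  atScale gen k (fun ω => F (S, fun j => (ω j).2) (fun j => (ω j).1))

/-- Level `0` of the bridge: evaluation at (the branch, zero fluctuation variables, the base gauge variables). [cite: Balaban1988Convergent, (2.20) p.258] -/
theorem tkOn218_zero [One G] [Zero V] (gen : ℕ → Op (MultiCfg P G V) ℝ) (S : ℕ → Set (Site P 0))
    (F : SFluct P V → B15DeterminingSets.MSField P G → ℝ) (V0 : GaugeField P 0 G) :
    tkOn218 gen 0 S F V0 = F (S, fun j => ((baseCfg (V := V) 0 V0) j).2) (fun j => ((baseCfg (V := V) 0 V0) j).1) := rfl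

/-! ### Restricted transports (the δ-constrained V-integration on a bond set), the V-factor, one generation's data -/

/-- A RESTRICTED TRANSPORT between the variables on two bond sets: takes a function of the fine bond variables (`ι → G`) to a function of the coarse
ones (`ι' → G`) — the abstract shape of «∫ dV_j|_{s} δ(V̄_j V_{j+1}⁻¹) (·)» read at `V_{j+1}|_{s'}`; of record the KERNEL version `kernelRT`, for a
successor any other version (VERSION CAVEAT). [cite: Balaban1988Convergent, (2.21) p.258] -/
abbrev RestrTransport (G : Type u) (ι ι' : Type*) := ((ι → G) → ℝ) → (ι' → G) → ℝ

/-- POSITIVITY PRESERVATION of a restricted transport (displayed law; PROVED for the kernel version). [cite: Balaban1988Convergent, (2.21) p.258] -/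
def RestrTransport.PosPres {G : Type u} {ι ι' : Type*} (T : RestrTransport G ι ι') : Prop :=
  ∀ f : (ι → G) → ℝ, (∀ y, 0 ≤ f y) → ∀ y', 0 ≤ T f y'

/-- THE V-FACTOR of (2.21) on the all-scales configuration: apply a restricted transport to the operand as a function of the scale-`j` bond variables on
`sV` (the others frozen), read at the scale-`(j+1)` variables on `sV'`. [cite: Balaban1988Convergent, (2.21) p.258] -/
def vOp (j : ℕ) [DecidableEq (PBond P j)] (sV : Finset (PBond P j)) (sV' : Finset (PBond P (j + 1))) (T : RestrTransport G ↥sV ↥sV') :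
    Op (MultiCfg P G V) ℝ :=
  fun F ω => T (fun y => F (Function.update ω j (Function.updateFinset (ω j).1 sV y, (ω j).2))) (fun b => (ω (j + 1)).1 b)

/-- `vOp` unfolded. [cite: Balaban1988Convergent, (2.21) p.258] -/
theorem vOp_apply (j : ℕ) [DecidableEq (PBond P j)] (sV : Finset (PBond P j)) (sV' : Finset (PBond P (j + 1))) (T : RestrTransport G ↥sV ↥sV')
    (F : MultiCfg P G V → ℝ) (ω : MultiCfg P G V) :
    vOp j sV sV' T F ω = T (fun y => F (Function.update ω j (Function.updateFinset (ω j).1 sV y, (ω j).2))) (fun b => (ω (j + 1)).1 b) := rfl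

/-- ONE GENERATION's DATA for (2.21) at scale `j`: the V-bond set `sV` and its image bond set `sV'`, the restricted transport `vT` (TRANSPORT-GENERIC: of record
the kernel version), the weight `ζ`, the A-bond set `sA`, the A-weight `w`. [cite: Balaban1988Convergent, (2.21) p.258] -/
structure GenData (P : Params) (G : Type u) (V : Type u) (j : ℕ) where
  sV : Finset (PBond P j)
  sV' : Finset (PBond P (j + 1))
  vT : RestrTransport G ↥sV ↥sV'
  ζ : MultiCfg P G V → ℝ
  sA : Finset (PBond P j)
  w : MultiCfg P G V → ℝ

/-- THE DISPLAYED LAWS of one generation's data the positivity face needs: the transport preserves positivity, the weights are nonnegative.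
[cite: Balaban1988Convergent, (2.21) p.258] -/
structure GenData.Laws {j : ℕ} (D : GenData P G V j) : Prop where
  vT_posPres : D.vT.PosPres
  zeta_nonneg : ∀ ω, 0 ≤ D.ζ ω
  w_nonneg : ∀ ω, 0 ≤ D.w ω

end Generic

/-! ### The A-factor (the tree's `fluctForm`) and the generation 𝐓^{(j)} -/

section ASide

variable {P : Params} {G : Type u} {V : Type u}
variable [NormedAddCommGroup V] [InnerProductSpace ℝ V] [FiniteDimensional ℝ V] [MeasurableSpace V] [BorelSpace V]

/-- **THE A-FACTOR** «∫ dA_j|_{sA} χ(…) exp[−½⟨A_j, 𝒬_j A_j⟩] (·)»: the tree's A-fibre node `fibreNodeA sA` (Lebesgue on the fluctuation variables on `sA`)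
after the weight `w`, lifted to the all-scales configuration (the weight may read every scale: [I]'s Gaussian form depends on the background field of the
retained variables). [cite: Balaban1988Convergent, (2.21) p.258] -/
def aOp (j : ℕ) [DecidableEq (PBond P j)] (sA : Finset (PBond P j)) (w : MultiCfg P G V → ℝ) : Op (MultiCfg P G V) ℝ :=
  fun F => liftOp j ((fibreNodeA (G := G) (V := V) sA).eval (E := ℝ)) (fun ω => w ω * F ω)

/-- `aOp` unfolded: the Lebesgue integral over the fluctuation variables on `sA` inserted at scale `j`. [cite: Balaban1988Convergent, (2.21) p.258] -/
theorem aOp_apply (j : ℕ) [DecidableEq (PBond P j)] (sA : Finset (PBond P j)) (w : MultiCfg P G V → ℝ) (F : MultiCfg P G V → ℝ)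
    (ω : MultiCfg P G V) :
    aOp j sA w F ω = ∫ a : ↥sA → V, w (Function.update ω j (insA sA a (ω j))) * F (Function.update ω j (insA sA a (ω j)))
      ∂(Measure.pi fun _ : ↥sA => (volume : Measure V)) := rfl

/-- **FORM-READING FACE**: the A-factor at scale `j` IS the tree's (2.21) fluctuation form `fluctForm sA w` (`T4AdjointCovariance`) evaluated on the scale-`j`
slice of the operand — so its adaptedness∕covariance faces (`adapted_fluctForm`, `covariant_fluctForm`) apply by name. [cite: Balaban1988Convergent, (2.21) p.258] -/
theorem aOp_eq_fluctForm_eval (j : ℕ) [DecidableEq (PBond P j)] (sA : Finset (PBond P j)) (w : MultiCfg P G V → ℝ) (F : MultiCfg P G V → ℝ)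
    (ω : MultiCfg P G V) :
    aOp j sA w F ω = (fluctForm sA (fun c => w (Function.update ω j c))).eval (E := ℝ) (fun c => F (Function.update ω j c)) (ω j) := rfl

/-- POSITIVITY of the A-factor: a nonnegative weight integrates nonnegative operands to nonnegative values. [cite: Balaban1988Convergent, (2.21) p.258] -/
theorem aOp_nonneg (j : ℕ) [DecidableEq (PBond P j)] (sA : Finset (PBond P j)) {w : MultiCfg P G V → ℝ} (hw : ∀ ω, 0 ≤ w ω)
    {F : MultiCfg P G V → ℝ} (hF : ∀ ω, 0 ≤ F ω) (ω : MultiCfg P G V) : 0 ≤ aOp j sA w F ω := by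
  rw [aOp_apply]
  exact integral_nonneg fun a => mul_nonneg (hw _) (hF _)

/-- THE NORMALISER FACE: an operand NOT DEPENDING on the integrated fluctuation variables comes out of the A-factor multiplied by `∫ w` (the shape of the
E-bookkeeping normalisers `z^{(k)}`, `log Z^{(k)}` of (3.23); no integrability needed). [cite: Balaban1988Convergent, (2.21) p.258, (3.23) p.270] -/
theorem aOp_of_indep (j : ℕ) [DecidableEq (PBond P j)] (sA : Finset (PBond P j)) (w : MultiCfg P G V → ℝ) (F : MultiCfg P G V → ℝ)
    (ω : MultiCfg P G V) (hF : ∀ a : ↥sA → V, F (Function.update ω j (insA sA a (ω j))) = F ω) :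
    aOp j sA w F ω = (∫ a : ↥sA → V, w (Function.update ω j (insA sA a (ω j))) ∂(Measure.pi fun _ : ↥sA => (volume : Measure V))) * F ω := by
  simp only [aOp_apply, hF]
  exact integral_mul_const _ _

/-- THE EMPTY-A-SET FACE ((2.22): «the last set» empty ⇒ no A-integral): with no fluctuation variables on `sA` the A-factor is multiplication by the weight
(Lebesgue on the one-point space `↥sA → V` is the Dirac mass). [cite: Balaban1988Convergent, (2.22) p.258] -/
theorem aOp_of_isEmpty (j : ℕ) [DecidableEq (PBond P j)] (sA : Finset (PBond P j)) [IsEmpty ↥sA] (w : MultiCfg P G V → ℝ)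
    (F : MultiCfg P G V → ℝ) (ω : MultiCfg P G V) : aOp j sA w F ω = w ω * F ω := by
  have hins : ∀ a : ↥sA → V, insA sA a (ω j) = ω j := fun a => by
    have h2 : Function.updateFinset (ω j).2 sA a = (ω j).2 := by
      funext b
      by_cases hb : b ∈ sA
      · exact isEmptyElim (⟨b, hb⟩ : ↥sA)
      · simp [Function.updateFinset_def, hb]
    unfold insA; rw [h2]
  simp only [aOp_apply, hins, Function.update_eq_self, integral_const, smul_eq_mul]
  rw [measureReal_def, Measure.pi_empty_univ, ENNReal.toReal_one, one_mul]

/-- **THE ONE-GENERATION OPERATION 𝐓^{(j)} of (2.21)**: V-factor after ζ-weight after A-factor (the A-integral is performed inside the V-integral, as printed).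
[cite: Balaban1988Convergent, (2.21) p.258] -/
def genOp (j : ℕ) [DecidableEq (PBond P j)] (D : GenData P G V j) : Op (MultiCfg P G V) ℝ :=
  fun F => vOp j D.sV D.sV' D.vT (zetaOp D.ζ (aOp j D.sA D.w F))

/-- `genOp` unfolded. [cite: Balaban1988Convergent, (2.21) p.258] -/
theorem genOp_apply (j : ℕ) [DecidableEq (PBond P j)] (D : GenData P G V j) (F : MultiCfg P G V → ℝ) :
    genOp j D F = vOp j D.sV D.sV' D.vT (zetaOp D.ζ (aOp j D.sA D.w F)) := rfl

/-- POSITIVITY of one generation under its laws. [cite: Balaban1988Convergent, (2.21) p.258] -/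
theorem genOp_nonneg (j : ℕ) [DecidableEq (PBond P j)] {D : GenData P G V j} (hD : D.Laws) {F : MultiCfg P G V → ℝ} (hF : ∀ ω, 0 ≤ F ω)
    (ω : MultiCfg P G V) : 0 ≤ genOp j D F ω := by
  rw [genOp_apply, vOp_apply]
  exact hD.vT_posPres _ (fun y => mul_nonneg (hD.zeta_nonneg _) (aOp_nonneg j D.sA hD.w_nonneg hF _)) _

end ASide

/-! ### The kernel version of the restricted transport (of record) and its faces -/

section Kernel

variable {P : Params} {G : Type u} {V : Type u}
variable [GaugeGroup G] [MeasurableSpace G] [HaarData G] [StandardBorelSpace G]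

/-- **THE KERNEL VERSION OF THE RESTRICTED TRANSPORT** (of record): the disintegration of product Haar on the fine bond variables along the restricted
averaging `avg`, read against product Haar on the coarse ones — marginal density × conditional law (`T4AveragingDisintegration.kernelTransport`), FILE 1's
`transportK` restricted to a bond set. [cite: Balaban1988Convergent, (2.21) p.258] -/
def kernelRT {ι ι' : Type*} [Fintype ι] [Fintype ι'] (avg : (ι → G) → (ι' → G)) : RestrTransport G ι ι' :=
  kernelTransport (Measure.pi fun _ : ι => (HaarData.haar : Measure G)) (Measure.pi fun _ : ι' => (HaarData.haar : Measure G)) avg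

/-- `kernelRT` unfolded. [cite: Balaban1988Convergent, (2.21) p.258] -/
theorem kernelRT_apply {ι ι' : Type*} [Fintype ι] [Fintype ι'] (avg : (ι → G) → (ι' → G)) (f : (ι → G) → ℝ) (y' : ι' → G) :
    kernelRT avg f y' = (margDensity (Measure.pi fun _ : ι => (HaarData.haar : Measure G)) (Measure.pi fun _ : ι' => (HaarData.haar : Measure G)) avg y' : ℝ) *
      ∫ y, f y ∂(condLaw (Measure.pi fun _ : ι => (HaarData.haar : Measure G)) avg y') := rfl

/-- The kernel transport PRESERVES POSITIVITY (`kernelTransport_nonneg`). [cite: Balaban1988Convergent, (2.21) p.258] -/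
theorem kernelRT_posPres {ι ι' : Type*} [Fintype ι] [Fintype ι'] (avg : (ι → G) → (ι' → G)) : (kernelRT avg).PosPres :=
  fun _ hf y' => kernelTransport_nonneg hf y'

/-- THE MARKOV FACE: a function CONSTANT in the integrated variables is transported to the constant times the transported unit density (the conditional
law is a Markov kernel). [cite: Balaban1988Convergent, (2.21) p.258] -/
theorem kernelRT_const {ι ι' : Type*} [Fintype ι] [Fintype ι'] (avg : (ι → G) → (ι' → G)) (c : ℝ) (y' : ι' → G) :
    kernelRT avg (fun _ => c) y' = kernelRT avg (fun _ => 1) y' * c := by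
  simp only [kernelRT_apply, integral_const, probReal_univ, smul_eq_mul, one_mul, mul_one]

/-- THE EMPTY-BOND-SET FACE: with NO variables on either side ((2.22)'s situation for the V-factor: `Ω^c_{j+1} ∩ X = ∅`) the kernel transport is the identity
— both laws are the Dirac mass of the one-point configuration space, the marginal density is `1` and the conditional law is that Dirac mass.
[cite: Balaban1988Convergent, (2.22) p.258] -/
theorem kernelRT_of_isEmpty {ι ι' : Type*} [Fintype ι] [Fintype ι'] [IsEmpty ι] [IsEmpty ι'] (avg : (ι → G) → (ι' → G)) (havg : Measurable avg)
    (f : (ι → G) → ℝ) (y' : ι' → G) (y : ι → G) : kernelRT avg f y' = f y := by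
  rw [kernelRT_apply]
  set ν : Measure (ι → G) := Measure.pi fun _ : ι => (HaarData.haar : Measure G) with hν
  set μ : Measure (ι' → G) := Measure.pi fun _ : ι' => (HaarData.haar : Measure G) with hμ
  have hνu : ν Set.univ = 1 := Measure.pi_empty_univ _
  have hμu : μ Set.univ = 1 := Measure.pi_empty_univ _
  -- the coarse marginal is `μ`
  have hmap : ν.map avg = μ := by
    ext s hs
    rw [Measure.map_apply havg hs]
    rcases Set.eq_empty_or_nonempty s with h | h
    · simp [h]
    · rw [Subsingleton.eq_univ_of_nonempty h, Set.preimage_univ, hνu, hμu]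
  have hfst : (jointLaw ν avg).fst = μ := by rw [jointLaw_fst ν havg, hmap]
  -- the marginal density is `1` at the (unique) coarse configuration
  have hpt : μ.rnDeriv μ y' = 1 := by
    have hae : ∀ᵐ x ∂μ, μ.rnDeriv μ x = 1 := Measure.rnDeriv_self μ
    by_contra hne
    have hall : ∀ x, ¬ μ.rnDeriv μ x = 1 := fun x => by rw [Subsingleton.elim x y']; exact hne
    have h0 : μ {x | ¬ μ.rnDeriv μ x = 1} = 0 := ae_iff.mp hae
    have huniv : {x | ¬ μ.rnDeriv μ x = 1} = Set.univ := Set.eq_univ_of_forall hall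
    rw [huniv, hμu] at h0
    exact one_ne_zero h0
  have hmarg : (margDensity ν μ avg y' : ℝ) = 1 := by
    simp [margDensity, T4TermReprCoupling.rnNN, hfst, hpt]
  -- the conditional law is a probability measure on a one-point space
  have hint : ∫ U, f U ∂(condLaw ν avg y') = f y := by
    have hc : ∀ U, f U = f y := fun U => by rw [Subsingleton.elim U y]
    calc ∫ U, f U ∂(condLaw ν avg y') = ∫ _U, f y ∂(condLaw ν avg y') := integral_congr_ae (ae_of_all _ hc)
      _ = f y := by rw [integral_const, probReal_univ, one_smul]
  rw [hmarg, hint, one_mul]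

/-- The V-factor of a function NOT DEPENDING on the integrated bond variables, kernel version: the function comes out multiplied by the transported unit
density. [cite: Balaban1988Convergent, (2.21) p.258] -/
theorem vOp_kernelRT_of_indep (j : ℕ) [DecidableEq (PBond P j)] (sV : Finset (PBond P j)) (sV' : Finset (PBond P (j + 1)))
    (avg : (↥sV → G) → (↥sV' → G)) (F : MultiCfg P G V → ℝ) (ω : MultiCfg P G V)
    (hF : ∀ y : ↥sV → G, F (Function.update ω j (Function.updateFinset (ω j).1 sV y, (ω j).2)) = F ω) :
    vOp j sV sV' (kernelRT avg) F ω = kernelRT avg (fun _ => 1) (fun b => (ω (j + 1)).1 b) * F ω := by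
  simp only [vOp_apply, hF]
  exact kernelRT_const avg (F ω) _

/-- The V-factor with NO variables on either bond set, kernel version, is the identity. [cite: Balaban1988Convergent, (2.22) p.258] -/
theorem vOp_kernelRT_of_isEmpty (j : ℕ) [DecidableEq (PBond P j)] (sV : Finset (PBond P j)) (sV' : Finset (PBond P (j + 1)))
    [IsEmpty ↥sV] [IsEmpty ↥sV'] (avg : (↥sV → G) → (↥sV' → G)) (havg : Measurable avg) (F : MultiCfg P G V → ℝ) (ω : MultiCfg P G V) :
    vOp j sV sV' (kernelRT avg) F ω = F ω := by
  rw [vOp_apply, kernelRT_of_isEmpty avg havg _ _ (fun b => (ω j).1 b)]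
  have h1 : Function.updateFinset (ω j).1 sV (fun b : ↥sV => (ω j).1 b) = (ω j).1 := by
    funext b
    by_cases hb : b ∈ sV
    · exact isEmptyElim (⟨b, hb⟩ : ↥sV)
    · simp [Function.updateFinset_def, hb]
  simp only [h1, Prod.mk.eta, Function.update_eq_self]

/-- A generation whose three bond sets are EMPTY (no large field at that generation: `Ω_{j+1} = Λ_{j+1} =` the whole lattice), kernel version, is
multiplication by its two weights — (2.22) and the no-large-field branch. [cite: Balaban1988Convergent, (2.22) p.258] -/
theorem genOp_of_isEmpty [NormedAddCommGroup V] [InnerProductSpace ℝ V] [FiniteDimensional ℝ V] [MeasurableSpace V] [BorelSpace V]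
    (j : ℕ) [DecidableEq (PBond P j)] (sV : Finset (PBond P j)) (sV' : Finset (PBond P (j + 1))) (sA : Finset (PBond P j))
    [IsEmpty ↥sV] [IsEmpty ↥sV'] [IsEmpty ↥sA] (avg : (↥sV → G) → (↥sV' → G)) (havg : Measurable avg) (ζ w : MultiCfg P G V → ℝ)
    (F : MultiCfg P G V → ℝ) (ω : MultiCfg P G V) :
    genOp j ⟨sV, sV', kernelRT avg, ζ, sA, w⟩ F ω = ζ ω * (w ω * F ω) := by
  rw [genOp_apply, vOp_kernelRT_of_isEmpty _ _ _ avg havg, zetaOp_apply, aOp_of_isEmpty]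

end Kernel

/-! ## §2  The `{S_j}`-index of (2.1) for a sequence `s = ({Ω_j},{Λ_j})` (generic over r11's `Seq D k`) -/

section SIndex

open B14.Eq218Concrete

variable {α : Type*} {D : ℕ → Set (Set α)} {k : ℕ}

/-- THE ADMISSIBLE `{S_j}`-SEQUENCES of (2.1) p. 254 for the sequence `s`: *«S_j ⊂ Ω_j ∩ Λ_jᶜ, and S_j is either empty, or it is a union of LM₂R_j-cubes»*
(`C j` = the class of such unions at scale `j`), normalised to `∅` off the window `1 ≤ j ≤ k` (one printed sequence = one index, as r11's `Seq`).  The layer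
convention *«it contains Ω_j ∖ Ω_j^{∼−1}»* is carried by the χ-weights, not by the index (module docstring). [cite: Balaban1988Convergent, (2.1) p.254] -/
def AdmS (C : ℕ → Set (Set α)) (k : ℕ) (s : Seq D k) : Set (ℕ → Set α) :=
  {S | (∀ j, 1 ≤ j → j ≤ k → S j ∈ C j ∧ S j ⊆ s.Ω j ∩ (s.Λ j)ᶜ) ∧ ∀ j, ¬ (1 ≤ j ∧ j ≤ k) → S j = ∅}

/-- Membership in `AdmS`. [cite: Balaban1988Convergent, (2.1) p.254] -/
theorem mem_admS_iff (C : ℕ → Set (Set α)) (s : Seq D k) (S : ℕ → Set α) :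
    S ∈ AdmS C k s ↔ (∀ j, 1 ≤ j → j ≤ k → S j ∈ C j ∧ S j ⊆ s.Ω j ∩ (s.Λ j)ᶜ) ∧ ∀ j, ¬ (1 ≤ j ∧ j ≤ k) → S j = ∅ := Iff.rfl

/-- An admissible `{S_j}`-sequence is determined by its window. [cite: Balaban1988Convergent, (2.1) p.254] -/
theorem admS_injOn (C : ℕ → Set (Set α)) (s : Seq D k) :
    Set.InjOn (fun S : ℕ → Set α => fun i : Fin (k + 1) => S i) (AdmS C k s) := by
  intro S hS T hT h
  funext j
  by_cases hj : j ≤ k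
  · exact congrFun h ⟨j, Nat.lt_succ_of_le hj⟩
  · rw [hS.2 j (fun h' => hj h'.2), hT.2 j (fun h' => hj h'.2)]

/-- **FINITENESS OF THE `{S_j}`-SUM** on a finite lattice. [cite: Balaban1988Convergent, (2.1) p.254, (2.18) p.257] -/
theorem admS_finite [Finite α] (C : ℕ → Set (Set α)) (s : Seq D k) : (AdmS C k s).Finite :=
  Set.Finite.of_finite_image (Set.toFinite _) (admS_injOn C s)

/-- The `{S_j}`-index as a finite set (so that `Σ_{{S_j}}` elaborates as a `Finset.sum`). [cite: Balaban1988Convergent, (2.1) p.254, (2.18) p.257] -/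
def admSSeq [Finite α] (C : ℕ → Set (Set α)) (k : ℕ) (s : Seq D k) : Finset (ℕ → Set α) :=
  (admS_finite C s).toFinset

/-- Membership in the finite `{S_j}`-index. [cite: Balaban1988Convergent, (2.1) p.254] -/
theorem mem_admSSeq_iff [Finite α] (C : ℕ → Set (Set α)) (s : Seq D k) (S : ℕ → Set α) :
    S ∈ admSSeq C k s ↔ (∀ j, 1 ≤ j → j ≤ k → S j ∈ C j ∧ S j ⊆ s.Ω j ∩ (s.Λ j)ᶜ) ∧ ∀ j, ¬ (1 ≤ j ∧ j ≤ k) → S j = ∅ := by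
  rw [admSSeq, Set.Finite.mem_toFinset, mem_admS_iff]

/-- The all-empty sequence *«S_j is either empty, or …»* is an index as soon as `∅` is in every class. [cite: Balaban1988Convergent, (2.1) p.254] -/
theorem const_empty_mem_admSSeq [Finite α] (C : ℕ → Set (Set α)) (hC : ∀ j, (∅ : Set α) ∈ C j) (s : Seq D k) :
    (fun _ => (∅ : Set α)) ∈ admSSeq C k s := by
  rw [mem_admSSeq_iff]
  exact ⟨fun j _ _ => ⟨hC j, Set.empty_subset _⟩, fun _ _ => rfl⟩

/-- At `k = 0` (empty window) the only index is the all-empty sequence. [cite: Balaban1988Convergent, (2.1) p.254] -/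
theorem admSSeq_zero [Finite α] (C : ℕ → Set (Set α)) (hC : ∀ j, (∅ : Set α) ∈ C j) (s : Seq D 0) :
    admSSeq C 0 s = {fun _ => (∅ : Set α)} := by
  ext S
  rw [Finset.mem_singleton, mem_admSSeq_iff]
  constructor
  · rintro ⟨-, hoff⟩
    funext j
    exact hoff j (fun h => by omega)
  · rintro rfl
    exact (mem_admSSeq_iff C s _).1 (const_empty_mem_admSSeq C hC s)

/-- In the no-large-field branch of a sequence (`Λ_j = Ω_j` on the window, as after an R-operation at every step: r11's `Adm21.of_eq`) the only index is
the all-empty sequence (*«S_j ⊂ Ω_j ∩ Λ_jᶜ»* `= ∅`). [cite: Balaban1988Convergent, (2.1) p.254] -/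
theorem admSSeq_of_eq [Finite α] (C : ℕ → Set (Set α)) (hC : ∀ j, (∅ : Set α) ∈ C j) (s : Seq D k)
    (hs : ∀ j, 1 ≤ j → j ≤ k → s.Λ j = s.Ω j) : admSSeq C k s = {fun _ => (∅ : Set α)} := by
  ext S
  rw [Finset.mem_singleton, mem_admSSeq_iff]
  constructor
  · rintro ⟨hwin, hoff⟩
    funext j
    by_cases hj : 1 ≤ j ∧ j ≤ k
    · have h := (hwin j hj.1 hj.2).2
      rw [hs j hj.1 hj.2, Set.inter_compl_self] at h
      exact Set.subset_empty_iff.mp h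
    · exact hoff j hj
  · rintro rfl
    exact (mem_admSSeq_iff C s _).1 (const_empty_mem_admSSeq C hC s)

end SIndex

end Tk

/-! ## §3  OF RECORD: `G = SU(N)`, the restricted averaging of record, the S-classes, the weight datum, `TkOfRecord` -/

section OfRecord

open Tk B10Eq42TorusConstraint B14.Eq218Concrete

variable (F : T4Family) (N : ℕ) (V : Type)

/-- **THE RESIDUAL WEIGHT DATUM OF RECORD for 𝐓_k** (like FILE 1's `StepWeightsOfRecord`; REGION-INDEXED, reading the all-scales configuration): `ζ j Y` = ζ_j(Y),
print's `ζ(Ω^c_{j+1})` (resummed characteristic functions and gauge-fixing factors localized in `Y`, [III] p. 248, p. 267); `quad j Λ'` = the value `⟨A_j, 𝒬_j A_j⟩`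
of [I]'s fluctuation form `𝒬_j = C*Δ^{(j)}C − C*Δ^{(j)}CC^{(j)}(Λ')C*Δ^{(j)}C` at the background field of the retained variables ((1.15)–(1.16), (1.26) [III];
`B12Eq15QuadraticForm`-shaped objects of record, NOT constructed here); `chiA j Y S` = the fluctuation-field characteristic functions `χ(Y, S)` of (2.21)∕(3.21)
(`Y = Z_{j+1} ∩ Ω_{j+1}`, `S = S_{j+1}`; by convention `0` on the `S` the layer rule of (2.1) excludes). [cite: Balaban1988Convergent, (2.21) p.258, (3.21) p.269, (3.23) p.270] -/
structure TkWeights (K : ℕ) where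
  ζ : ℕ → Set (Site (F.P K) 0) → MultiCfg (F.P K) (SU N) V → ℝ
  quad : ℕ → Set (Site (F.P K) 0) → MultiCfg (F.P K) (SU N) V → ℝ
  chiA : ℕ → Set (Site (F.P K) 0) → Set (Site (F.P K) 0) → MultiCfg (F.P K) (SU N) V → ℝ

variable {F N V} in
/-- THE A-WEIGHT of generation `j` for the small-field domain `Λ'` (= Λ_{j+1}), the region `Y` (= Z_{j+1} ∩ Ω_{j+1}) and `S` (= S_{j+1}):
`χ(Y, S) · exp(−½⟨A_j, 𝒬_j(Λ') A_j⟩)` (un-normalised; the normalisers are the E-bookkeeping of (3.23)). [cite: Balaban1988Convergent, (2.21) p.258, (3.23) p.270] -/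
def TkWeights.w {K : ℕ} (W : TkWeights F N V K) (j : ℕ) (Λ' Y S : Set (Site (F.P K) 0)) : MultiCfg (F.P K) (SU N) V → ℝ :=
  fun ω => W.chiA j Y S ω * Real.exp (-(1 / 2 : ℝ) * W.quad j Λ' ω)

variable {F N V} in
/-- THE DISPLAYED LAWS of the weight datum the faces need (nothing of [I]'s estimates asserted): `ζ ≥ 0`, `0 ≤ χ ≤ 1`. [cite: Balaban1988Convergent, (2.21) p.258] -/
structure TkWeights.Laws {K : ℕ} (W : TkWeights F N V K) : Prop where
  zeta_nonneg : ∀ j Y ω, 0 ≤ W.ζ j Y ω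
  chiA_nonneg : ∀ j Y S ω, 0 ≤ W.chiA j Y S ω
  chiA_le_one : ∀ j Y S ω, W.chiA j Y S ω ≤ 1

variable {F N V} in
/-- The A-weights are nonnegative under the laws. [cite: Balaban1988Convergent, (2.21) p.258] -/
theorem TkWeights.w_nonneg {K : ℕ} {W : TkWeights F N V K} (hW : W.Laws) (j : ℕ) (Λ' Y S : Set (Site (F.P K) 0))
    (ω : MultiCfg (F.P K) (SU N) V) : 0 ≤ W.w j Λ' Y S ω :=
  mul_nonneg (hW.chiA_nonneg j Y S ω) (Real.exp_nonneg _)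

variable {F N V} in
/-- The A-weights are at most `1` when the form value is nonnegative ([I]'s positivity of `𝒬_j` — a DISPLAYED hypothesis, not asserted).
[cite: Balaban1988Convergent, (2.21) p.258] -/
theorem TkWeights.w_le_one {K : ℕ} {W : TkWeights F N V K} (hW : W.Laws) (j : ℕ) (Λ' Y S : Set (Site (F.P K) 0))
    (ω : MultiCfg (F.P K) (SU N) V) (hq : 0 ≤ W.quad j Λ' ω) : W.w j Λ' Y S ω ≤ 1 := by
  unfold TkWeights.w
  have h1 : Real.exp (-(1 / 2 : ℝ) * W.quad j Λ' ω) ≤ 1 := Real.exp_le_one_iff.mpr (by linarith)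
  calc W.chiA j Y S ω * Real.exp (-(1 / 2 : ℝ) * W.quad j Λ' ω) ≤ 1 * 1 :=
        mul_le_mul (hW.chiA_le_one j Y S ω) h1 (Real.exp_nonneg _) zero_le_one
    _ = 1 := one_mul 1

/-- THE S-CLASSES OF RECORD along a coupling sequence `g`: unions of `LM₂R_j`-cubes of the lattice `T_{L^{−j}}` (side `cubeSide L M₂ R_j j` fine sites,
`R_j = RkOfRecord L r g_j` (2.5), the same cube family as `chiSeqOfRecord`'s). [cite: Balaban1988Convergent, (2.1) p.254, (2.5) p.255] -/
def SClassOfRecord (ν : Stage7Numerics) (g : ℕ → ℝ) (K : ℕ) : ℕ → Set (Set (Site (F.P K) 0)) :=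
  fun j => unionsOfCubes (F.P K) (cubeSide (F.P K).L ν.M₂ (RkOfRecord (F.P K).L ν.r (g j)) j)

/-- The empty region is in every S-class of record. [cite: Balaban1988Convergent, (2.1) p.254] -/
theorem empty_mem_SClassOfRecord (ν : Stage7Numerics) (g : ℕ → ℝ) (K j : ℕ) : (∅ : Set (Site (F.P K) 0)) ∈ SClassOfRecord F ν g K j :=
  empty_mem_unionsOfCubes (F.P K) _

/-- THE `{S_j}`-INDEX OF RECORD for a sequence of record `s`. [cite: Balaban1988Convergent, (2.1) p.254] -/
def admSOfRecord (ν : Stage7Numerics) (M : ℕ) (g : ℕ → ℝ) (K k : ℕ) (s : SeqOfRecord F ν M g K k) : Finset (ℕ → Set (Site (F.P K) 0)) :=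
  admSSeq (SClassOfRecord F ν g K) k s

/-- At `k = 0` the index of record is the all-empty sequence alone. [cite: Balaban1988Convergent, (2.1) p.254] -/
theorem admSOfRecord_zero (ν : Stage7Numerics) (M : ℕ) (g : ℕ → ℝ) (K : ℕ) (s : SeqOfRecord F ν M g K 0) :
    admSOfRecord F ν M g K 0 s = {fun _ => (∅ : Set (Site (F.P K) 0))} :=
  admSSeq_zero _ (empty_mem_SClassOfRecord F ν g K) s

/-- In the no-large-field branch of a sequence of record (`Λ_j = Ω_j` on the window) the index is the all-empty sequence alone.
[cite: Balaban1988Convergent, (2.1) p.254] -/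
theorem admSOfRecord_of_eq (ν : Stage7Numerics) (M : ℕ) (g : ℕ → ℝ) (K k : ℕ) (s : SeqOfRecord F ν M g K k)
    (hs : ∀ j, 1 ≤ j → j ≤ k → s.Λ j = s.Ω j) : admSOfRecord F ν M g K k s = {fun _ => (∅ : Set (Site (F.P K) 0))} :=
  admSSeq_of_eq _ (empty_mem_SClassOfRecord F ν g K) s hs

variable [NeZero N]

/-- THE RESTRICTED AVERAGING OF RECORD on a bond set: Bałaban's block averaging of record `avOfRecord F N K j` ((1.4) [III], [Balaban1985Averaging] (10))
applied to the field extended by `1` off `sV`, read on `sV'`. [cite: Balaban1988Convergent, (2.21) p.258, (1.4) p.246] -/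
def avgRestrOfRecord (K j : ℕ) [DecidableEq (PBond (F.P K) j)] (sV : Finset (PBond (F.P K) j)) (sV' : Finset (PBond (F.P K) (j + 1))) :
    (↥sV → SU N) → (↥sV' → SU N) :=
  fun y b' => (avOfRecord F N K j).avg (Function.updateFinset (fun _ => 1) sV y) b'

/-- THE RESTRICTED TRANSPORT OF RECORD on a pair of bond sets: the kernel version along the restricted averaging of record.
[cite: Balaban1988Convergent, (2.21) p.258] -/
def kernelRTOfRecord (K j : ℕ) [DecidableEq (PBond (F.P K) j)] (sV : Finset (PBond (F.P K) j)) (sV' : Finset (PBond (F.P K) (j + 1))) :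
    RestrTransport (SU N) ↥sV ↥sV' :=
  kernelRT (avgRestrOfRecord F N K j sV sV')

/-- The restricted transport of record preserves positivity. [cite: Balaban1988Convergent, (2.21) p.258] -/
theorem kernelRTOfRecord_posPres (K j : ℕ) [DecidableEq (PBond (F.P K) j)] (sV : Finset (PBond (F.P K) j))
    (sV' : Finset (PBond (F.P K) (j + 1))) : (kernelRTOfRecord F N K j sV sV').PosPres :=
  kernelRT_posPres _

/-- **ONE GENERATION's DATA OF RECORD** at scale `j` for the sequence `s = ({Ω_i},{Λ_i})` and the branch `S = {S_i}`: V-bonds = the level-`j` bonds in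
`Ω^c_{j+1}`, image bonds = the level-`(j+1)` bonds there, transport = the kernel transport of record, `ζ = ζ_j(Ω^c_{j+1})`, A-bonds = the level-`j` bonds in
`Z_{j+1} ∩ Ω_{j+1}` with `Z_{j+1} = Λ^c_{j+1}` ((2.3) p. 255 «We denote further Z_j = Λ_jᶜ»; (3.23): «dA_k|_{Ω_{k+1} ∩ Λ^c_{k+1}}»), A-weight =
`χ(Z_{j+1} ∩ Ω_{j+1}, S_{j+1}) exp(−½⟨A_j, 𝒬_j(Λ_{j+1}) A_j⟩)`. [cite: Balaban1988Convergent, (2.3) p.255, (2.21) p.258, (3.23) p.270] -/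
def genDataOfRecord (ν : Stage7Numerics) (M : ℕ) (g : ℕ → ℝ) (K : ℕ) (W : TkWeights F N V K) {k : ℕ} (s : SeqOfRecord F ν M g K k)
    (S : ℕ → Set (Site (F.P K) 0)) (j : ℕ) [DecidableEq (PBond (F.P K) j)] : GenData (F.P K) (SU N) V j where
  sV := (Set.toFinite (bondsIn j (s.Ω (j + 1))ᶜ)).toFinset
  sV' := (Set.toFinite (bondsIn (j + 1) (s.Ω (j + 1))ᶜ)).toFinset
  vT := kernelRTOfRecord F N K j _ _
  ζ := W.ζ j (s.Ω (j + 1))ᶜ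
  sA := (Set.toFinite (bondsIn j ((s.Λ (j + 1))ᶜ ∩ s.Ω (j + 1)))).toFinset
  w := W.w j (s.Λ (j + 1)) ((s.Λ (j + 1))ᶜ ∩ s.Ω (j + 1)) (S (j + 1))

/-- The generation data of record satisfy the generation laws under the weight laws (transport positivity PROVED, weights by the laws).
[cite: Balaban1988Convergent, (2.21) p.258] -/
theorem genDataOfRecord_laws (ν : Stage7Numerics) (M : ℕ) (g : ℕ → ℝ) (K : ℕ) {W : TkWeights F N V K} (hW : W.Laws) {k : ℕ}
    (s : SeqOfRecord F ν M g K k) (S : ℕ → Set (Site (F.P K) 0)) (j : ℕ) [DecidableEq (PBond (F.P K) j)] :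
    (genDataOfRecord F N V ν M g K W s S j).Laws where
  vT_posPres := kernelRTOfRecord_posPres F N K j _ _
  zeta_nonneg := fun ω => hW.zeta_nonneg j _ ω
  w_nonneg := fun ω => TkWeights.w_nonneg hW j _ _ _ ω

variable [NormedAddCommGroup V] [InnerProductSpace ℝ V] [FiniteDimensional ℝ V] [MeasurableSpace V] [BorelSpace V]

open Classical in
/-- **THE BRANCH OPERATOR 𝐓_k(s, S)** = the ordered product (2.20) of the generations of record, as an operation on the all-scales configuration.
[cite: Balaban1988Convergent, (2.20)–(2.21) p.258] -/
def tkBranchOfRecord (ν : Stage7Numerics) (M : ℕ) (g : ℕ → ℝ) (K : ℕ) (W : TkWeights F N V K) {k : ℕ} (s : SeqOfRecord F ν M g K k)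
    (S : ℕ → Set (Site (F.P K) 0)) : ℕ → Op (MultiCfg (F.P K) (SU N) V) ℝ :=
  tkOp fun j => genOp j (genDataOfRecord F N V ν M g K W s S j)

open Classical in
/-- **(3.24) FOR THE BRANCH OPERATOR**: `𝐓_{i+1}(s, S) = 𝐓^{(i)}(s, S) 𝐓_i(s, S)` (definitional). [cite: Balaban1988Convergent, (3.24) p.270] -/
theorem tkBranchOfRecord_succ (ν : Stage7Numerics) (M : ℕ) (g : ℕ → ℝ) (K : ℕ) (W : TkWeights F N V K) {k : ℕ} (s : SeqOfRecord F ν M g K k)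
    (S : ℕ → Set (Site (F.P K) 0)) (i : ℕ) (Φ : MultiCfg (F.P K) (SU N) V → ℝ) :
    tkBranchOfRecord F N V ν M g K W s S (i + 1) Φ = genOp i (genDataOfRecord F N V ν M g K W s S i) (tkBranchOfRecord F N V ν M g K W s S i Φ) := rfl

/-- `𝐓_0(s, S)` is the identity. [cite: Balaban1988Convergent, (2.20) p.258] -/
theorem tkBranchOfRecord_zero (ν : Stage7Numerics) (M : ℕ) (g : ℕ → ℝ) (K : ℕ) (W : TkWeights F N V K) {k : ℕ} (s : SeqOfRecord F ν M g K k)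
    (S : ℕ → Set (Site (F.P K) 0)) (Φ : MultiCfg (F.P K) (SU N) V → ℝ) : tkBranchOfRecord F N V ν M g K W s S 0 Φ = Φ := rfl

open Classical in
/-- **`𝐓_k(s)` OF RECORD IN r11's SLOT SHAPE** `Seq D k → (𝔄 → MSField → ℝ) → Density _ k _` (`Adm := SeqOfRecord`, `𝔄 := SFluct` — the type of
`B14.Eq218Concrete.Data218.Tk`, so 11c's datum of record takes `TkOfRecord … k` as its `Tk` field verbatim, with r11's `expA act bg s` as operand): the
sum over the `{S_j}`-index of record of the branch operators applied to the operand at that branch, read at scale `k`.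
[cite: Balaban1988Convergent, (2.18) p.257, (2.20)–(2.21) p.258] -/
def TkOfRecord (ν : Stage7Numerics) (M : ℕ) (g : ℕ → ℝ) (K : ℕ) (W : TkWeights F N V K) (k : ℕ) (s : SeqOfRecord F ν M g K k)
    (Φ : SFluct (F.P K) V → B15DeterminingSets.MSField (F.P K) (SU N) → ℝ) : Density (F.P K) k (SU N) :=
  fun Vk => ∑ S ∈ admSOfRecord F ν M g K k s, tkOn218 (fun j => genOp j (genDataOfRecord F N V ν M g K W s S j)) k S Φ Vk

/-! ## §4  Faces of `TkOfRecord` -/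

/-- `TkOfRecord` unfolded through the branch operators. [cite: Balaban1988Convergent, (2.18) p.257] -/
theorem TkOfRecord_apply (ν : Stage7Numerics) (M : ℕ) (g : ℕ → ℝ) (K : ℕ) (W : TkWeights F N V K) (k : ℕ) (s : SeqOfRecord F ν M g K k)
    (Φ : SFluct (F.P K) V → B15DeterminingSets.MSField (F.P K) (SU N) → ℝ) (Vk : GaugeField (F.P K) k (SU N)) :
    TkOfRecord F N V ν M g K W k s Φ Vk = ∑ S ∈ admSOfRecord F ν M g K k s,
      tkBranchOfRecord F N V ν M g K W s S k (fun ω => Φ (S, fun j => (ω j).2) (fun j => (ω j).1)) (baseCfg k Vk) := rfl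

/-- **THE `k = 0` FACE** (the Wilson start carries no large-field variables and no `{S_j}`): `(𝐓_0 Φ)(V_0) = Φ(∅-branch, A = 0, base gauge variables)`.
[cite: Balaban1988Convergent, (2.20) p.258] -/
theorem TkOfRecord_zero (ν : Stage7Numerics) (M : ℕ) (g : ℕ → ℝ) (K : ℕ) (W : TkWeights F N V K) (s : SeqOfRecord F ν M g K 0)
    (Φ : SFluct (F.P K) V → B15DeterminingSets.MSField (F.P K) (SU N) → ℝ) (V0 : GaugeField (F.P K) 0 (SU N)) :
    TkOfRecord F N V ν M g K W 0 s Φ V0 =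
      Φ (fun _ => ∅, fun j => ((baseCfg (V := V) 0 V0) j).2) (fun j => ((baseCfg (V := V) 0 V0) j).1) := by
  rw [TkOfRecord_apply, admSOfRecord_zero, Finset.sum_singleton]
  rfl

/-- THE NO-LARGE-FIELD BRANCH: on a sequence with `Λ_j = Ω_j` on the window, `𝐓_k(s)` is the single all-empty `{S_j}`-branch.
[cite: Balaban1988Convergent, (2.18) p.257, (2.1) p.254] -/
theorem TkOfRecord_of_eq (ν : Stage7Numerics) (M : ℕ) (g : ℕ → ℝ) (K : ℕ) (W : TkWeights F N V K) (k : ℕ) (s : SeqOfRecord F ν M g K k)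
    (hs : ∀ j, 1 ≤ j → j ≤ k → s.Λ j = s.Ω j) (Φ : SFluct (F.P K) V → B15DeterminingSets.MSField (F.P K) (SU N) → ℝ)
    (Vk : GaugeField (F.P K) k (SU N)) :
    TkOfRecord F N V ν M g K W k s Φ Vk =
      tkBranchOfRecord F N V ν M g K W s (fun _ => ∅) k (fun ω => Φ (fun _ => ∅, fun j => (ω j).2) (fun j => (ω j).1)) (baseCfg k Vk) := by
  rw [TkOfRecord_apply, admSOfRecord_of_eq F ν M g K k s hs, Finset.sum_singleton]

open Classical in
/-- **POSITIVITY OF `𝐓_k(s)` OF RECORD** under the weight laws: nonnegative operands (r11's `expA`, an exponential) have nonnegative images — the shape FILE 10's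
`0 ≤ slot` proviso and 11c's identity law consume. [cite: Balaban1988Convergent, (2.18) p.257, (2.21) p.258] -/
theorem TkOfRecord_nonneg (ν : Stage7Numerics) (M : ℕ) (g : ℕ → ℝ) (K : ℕ) {W : TkWeights F N V K} (hW : W.Laws) (k : ℕ)
    (s : SeqOfRecord F ν M g K k) {Φ : SFluct (F.P K) V → B15DeterminingSets.MSField (F.P K) (SU N) → ℝ} (hΦ : ∀ a U, 0 ≤ Φ a U)
    (Vk : GaugeField (F.P K) k (SU N)) : 0 ≤ TkOfRecord F N V ν M g K W k s Φ Vk := by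
  rw [TkOfRecord_apply]
  refine Finset.sum_nonneg fun S _ => ?_
  exact tkOp_nonneg _ (fun j _ hF' => genOp_nonneg j (genDataOfRecord_laws F N V ν M g K hW s S j) hF') k (fun _ => hΦ _ _) _

end OfRecord

end Literature.MathematicalPhysics.QuantumFieldTheory.Balaban1983to89.Node00
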